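import Literature.NumberTheory.Automorphic.UnitaryGroupCohomologicalForms
import Literature.NumberTheory.Automorphic.RealMatrixGroupsExpOpen
import Literature.AlgebraicGeometry.ShimuraVarieties.UnitaryBallLieDerivative
import Literature.AlgebraicGeometry.ShimuraVarieties.UnitaryBallCotangentWeight
import Mathlib.Analysis.SpecialFunctions.Exponential
import HarnessLib

/-!
# F0-P2a · S2⁺ preliminaries (lead p01): regularity of `U(2,1)` as a linear real group, slice continuity of
# archimedean-smooth functions, the open level of a smooth vector, and the INFINITESIMAL `K`-type / Cauchy–Riemann
# identities of a holomorphic cotangent form (crux `H413`, item `stmt-HodgeConjecture-24833`, line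
# `Cruxes/H413/Lines/F0_P2aCohIsotypicLine.lean`, stub S2⁺ `stub_archOrth_hol`)

Cell hodgecm-mathlib, FLOOR 0.  THEOREMS ONLY (no `def`, no `sorry`, no named-fact hypothesis); `--supports
stmt-HodgeConjecture-24833 --as helper`.  These are the «V₀-facts» and the regularity plumbing of the CUT of S2⁺
(`F0/P2a/F0P2a-p01/CUT-S2plus.v1.md`): for a function `Φ` with holomorphic germs along a section `ι : U(2,1) → G` and of
right `K_∞`-type the cotangent isotropy representation `τ = weightOf x₀` (★ `weightForms`, ★ `weightOf_cotangent_apply`):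

* §1 `u21Group_regular` — `𝔲(2,1)` is the FULL Lie algebra of `U(2,1)` (`exp tX ∈ U(2,1) ∀ t ⇒ Xᴴ J + J X = 0`; the hypothesis
  `hreg` of ★ `RealMatrixGroupsExpOpen` / `ArchimedeanCalculusRegular`), and `continuous_slice_of_isArchSmooth` — an
  archimedean-smooth function has continuous `U(2,1)`-slices `u ↦ ψ (x · ι u)` (★ `continuous_of_continuousAt_comp_expMem`);
* §2 `exists_isOpen_forall_apply_mul_eq_of_mem_smoothFun` — a smooth vector is fixed by ONE open subgroup of `U(J)(𝔸_{F,f})`;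
* §3 `lieDeriv_liePMat_eq_fderiv_germAt`, `lieDeriv_liePMat_I_smul_of_isHolGerm` — the Cauchy–Riemann identity
  `X_{ib} Φⱼ = i · X_b Φⱼ` ON THE WHOLE GROUP from ★ `CotangentForms.IsHolGerm` (first-order germs suffice);
* §4 `exists_stabilizer_coe_eq_expMem`, `apply_mul_expMem_eq_of_weight`, `lieDeriv_of_weight_eq`,
  `lieDeriv_h0_of_weight` — for `Y ∈ 𝔨 = {Y ∈ 𝔲(2,1) | YJ = JY}`, `exp tY ∈ Stab(x₀)`, the `K`-type relation along `exp tY`,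
  and the infinitesimal `K`-type: `Y Φⱼ = ∑ᵢ Dⱼᵢ Φᵢ` (explicit `D`), in particular `h₀ Φⱼ = 2i Φⱼ` for `h₀ = i·J = i·diag(1,1,−1)`.

HC_CM is proved only modulo the printed citations until rung 0 closes; this file discharges none of them.

## References
* [BorelJacquet1979] A. Borel, H. Jacquet, Corvallis PSPM 33.1, §1.5 (Lie derivatives by right translation), §4.2.
* [Borel1997] A. Borel, *Automorphic forms on SL₂(ℝ)*, §2.1 (4), §5.14 (forms of a `K`-type read on the group).
* [Hall2015] B. C. Hall, *Lie Groups, Lie Algebras, and Representations*, 2nd ed., Cor. 3.44–3.45.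
* [Knapp2002] A. W. Knapp, *Lie Groups Beyond an Introduction*, I.§10 (Prop. 1.88: the Lie algebra of a closed linear group).
* [BorelWallach2000] A. Borel, N. Wallach, *Continuous cohomology…*, 2nd ed., VI 4.8 (the isotropy representation `𝔭₋`).
-/

set_option autoImplicit false
set_option linter.dupNamespace false

noncomputable section

open scoped Matrix MatrixGroups Topology ContDiff ComplexConjugate
open Filter MulAction
open Literature.NumberTheory.Automorphic
open Literature.Geometry.ComplexHyperbolic Literature.Geometry.ComplexHyperbolic.BallModel
open Literature.AlgebraicGeometry.ShimuraVarieties Literature.AlgebraicGeometry.ShimuraVarieties.BallForms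
open Literature.NumberTheory.Automorphic.AutomorphyFactor

namespace Summit.HodgeConjecture.HodgeConjecture.Cruxes.H413.F0P2aArchOrthPrelim

/-! ## §1 `𝔲(2,1)` is the full Lie algebra of `U(2,1)`; slice continuity of archimedean-smooth functions -/

-- The scoped `L∞` operator norm on matrices (reducibly defeq to the Pi topology, as in
-- `Mathlib/Analysis/Normed/Algebra/MatrixExponential.lean`) is used for `hasDerivAt_exp_smul_const'`.
set_option backward.isDefEq.respectTransparency false in
open scoped Matrix.Norms.Operator in
/-- **`𝔲(2,1)` is the FULL Lie algebra of `U(2,1)`**: if `exp (tX) ∈ U(2,1)` for every real `t` then `Xᴴ J + J X = 0`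
(differentiate `t ↦ (exp tX)ᴴ J (exp tX) ≡ J` at `0`).  This is the hypothesis `hreg` of ★ `RealMatrixGroupsExpOpen` for
`BallForms.u21Group`. [cite: Knapp2002, I.§10 Prop. 1.88] -/
theorem u21Group_regular (X : Matrix (Fin 3) (Fin 3) ℂ) (hX : ∀ t : ℝ, expGL (t • X) ∈ u21Group.carrier) :
    X ∈ u21Group.lie := by
  show Xᴴ * J + J * X = 0
  have hconst : ∀ t : ℝ, (NormedSpace.exp (t • X))ᴴ * J * NormedSpace.exp (t • X) = J := fun t => by
    have h := hX t
    exact h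
  have hE : HasDerivAt (fun u : ℝ => NormedSpace.exp (u • X)) X 0 := by
    simpa using hasDerivAt_exp_smul_const' (𝕂 := ℝ) X 0
  have hEH : HasDerivAt (fun u : ℝ => (NormedSpace.exp (u • X))ᴴ) Xᴴ 0 := by
    have hfun : (fun u : ℝ => (NormedSpace.exp (u • X))ᴴ) = fun u : ℝ => NormedSpace.exp (u • Xᴴ) := by
      funext u
      rw [← Matrix.exp_conjTranspose, Matrix.conjTranspose_smul, star_trivial]
    rw [hfun]
    simpa using hasDerivAt_exp_smul_const' (𝕂 := ℝ) Xᴴ 0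
  have hprod : HasDerivAt (fun u : ℝ => (NormedSpace.exp (u • X))ᴴ * J * NormedSpace.exp (u • X))
      (Xᴴ * J * NormedSpace.exp ((0 : ℝ) • X) + (NormedSpace.exp ((0 : ℝ) • X))ᴴ * J * X) 0 :=
    (hEH.mul_const J).mul hE
  have hzero : HasDerivAt (fun u : ℝ => (NormedSpace.exp (u • X))ᴴ * J * NormedSpace.exp (u • X))
      (0 : Matrix (Fin 3) (Fin 3) ℂ) 0 := by
    rw [show (fun u : ℝ => (NormedSpace.exp (u • X))ᴴ * J * NormedSpace.exp (u • X)) = fun _ => J from funext hconst]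
    exact hasDerivAt_const 0 J
  have h := hprod.unique hzero
  simpa [zero_smul, NormedSpace.exp_zero, Matrix.conjTranspose_one] using h

set_option backward.isDefEq.respectTransparency false in
open scoped Matrix.Norms.Operator in
/-- **Slice continuity**: a function `ψ : G → ℂ` smooth in the archimedean variable along `ι : U(2,1) → G` has CONTINUOUS
slices `u ↦ ψ (x · ι u)` on `U(2,1)` (the exponential charts `X ↦ u₀ exp X` are open at `0`, ★
`RealMatrixGroup.continuous_of_continuousAt_comp_expMem`, `u21Group_regular`). [cite: Hall2015, Cor. 3.44] -/
theorem continuous_slice_of_isArchSmooth {G : Type*} [Group G] (ι : U21 →* G) {ψ : G → ℂ}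
    (hψ : IsArchSmooth (H := u21Group) ι ψ) (x : G) : Continuous fun u : U21 => ψ (x * ι u) := by
  refine u21Group.continuous_of_continuousAt_comp_expMem u21Group_regular (ψ := fun u : U21 => ψ (x * ι u)) fun u₀ => ?_
  have h := (hψ (x * ι u₀)).continuous.continuousAt (x := 0)
  refine h.congr (Filter.Eventually.of_forall fun X => ?_)
  dsimp only
  rw [map_mul, mul_assoc]
  rfl

/-! ## §2 The open level of a smooth vector -/

section Smooth

variable {F E : Type} [Field F] [NumberField F] [Field E] [NumberField E] [Algebra F E]
  {c : E ≃ₐ[F] E} {N : ℕ} {J₀ : Matrix (Fin N) (Fin N) E}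

/-- **A smooth vector is fixed by ONE open subgroup** of `U(J)(𝔸_{F,f})` (finite intersections of open subgroups are open;
`smoothFun` is the span of the invariants of the open subgroups). [cite: BorelJacquet1979, §4.2] -/
theorem exists_isOpen_forall_apply_mul_eq_of_mem_smoothFun {Φ : (UnitaryGroup.adelicGroupData F E c N J₀).Adelic → (Fin 2 → ℂ)}
    (hΦ : Φ ∈ UnitaryGroup.CotangentForms.smoothFun F E c N J₀) :
    ∃ Kf : Subgroup (UnitaryGroup.finAdelic F E c N J₀), IsOpen (Kf : Set (UnitaryGroup.finAdelic F E c N J₀)) ∧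
      ∀ k ∈ Kf, ∀ x, Φ (x * UnitaryGroup.finAdelicToAdelic F E c N J₀ k) = Φ x := by
  have key : ∃ Kf : Subgroup (UnitaryGroup.finAdelic F E c N J₀), IsOpen (Kf : Set (UnitaryGroup.finAdelic F E c N J₀)) ∧
      ∀ k ∈ Kf, UnitaryGroup.CotangentForms.rightRep F E c N J₀ k Φ = Φ := by
    refine Submodule.iSup_induction _
      (motive := fun Φ => ∃ Kf : Subgroup (UnitaryGroup.finAdelic F E c N J₀),
        IsOpen (Kf : Set (UnitaryGroup.finAdelic F E c N J₀)) ∧ ∀ k ∈ Kf, UnitaryGroup.CotangentForms.rightRep F E c N J₀ k Φ = Φ)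
      hΦ ?_ ?_ ?_
    · intro K Φ' hΦ'
      refine Submodule.iSup_induction _
        (motive := fun Φ => ∃ Kf : Subgroup (UnitaryGroup.finAdelic F E c N J₀),
          IsOpen (Kf : Set (UnitaryGroup.finAdelic F E c N J₀)) ∧ ∀ k ∈ Kf, UnitaryGroup.CotangentForms.rightRep F E c N J₀ k Φ = Φ)
        hΦ' ?_ ?_ ?_
      · intro hK Φ'' hΦ''
        exact ⟨K, hK, fun k hk => (Representation.mem_invariants _ _).1 hΦ'' ⟨k, hk⟩⟩
      · exact ⟨⊤, isOpen_univ, fun k _ => by simp⟩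
      · rintro a b ⟨Ka, hKa, ha⟩ ⟨Kb, hKb, hb⟩
        refine ⟨Ka ⊓ Kb, ?_, fun k hk => by rw [map_add, ha k hk.1, hb k hk.2]⟩
        rw [Subgroup.coe_inf]; exact hKa.inter hKb
    · exact ⟨⊤, isOpen_univ, fun k _ => by simp⟩
    · rintro a b ⟨Ka, hKa, ha⟩ ⟨Kb, hKb, hb⟩
      refine ⟨Ka ⊓ Kb, ?_, fun k hk => by rw [map_add, ha k hk.1, hb k hk.2]⟩
      rw [Subgroup.coe_inf]; exact hKa.inter hKb
  obtain ⟨Kf, hKf, h⟩ := key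
  exact ⟨Kf, hKf, fun k hk x => by
    have := congrFun (h k hk) x
    rwa [UnitaryGroup.CotangentForms.rightRep_apply] at this⟩

end Smooth

/-! ## §3 Lie derivatives along `𝔭` at an arbitrary base point and the Cauchy–Riemann identity from holomorphic germs -/

section CR

variable {G : Type*} [Group G] (ι : U21 →* G)

/-- The Lie derivative along `X_w ∈ 𝔭` at the base point `x ∈ G` is the real differential of the germ `b ↦ Φ (x · ι(expP b))`
at `0` applied to `w` (the germ is assumed real-differentiable at `0`). [cite: Borel1997, §2.1 (4)] -/
theorem lieDeriv_liePMat_eq_fderiv_germAt (Φ : G → (Fin 2 → ℂ)) (x : G) (j : Fin 2) (w : Fin 2 → ℂ)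
    (hd : DifferentiableAt ℝ (UnitaryGroup.CotangentForms.germAt ι Φ x) 0) :
    lieDeriv (H := u21Group) ι (liePMat w) (fun y => Φ y j) x =
      fderiv ℝ (UnitaryGroup.CotangentForms.germAt ι Φ x) 0 w j := by
  simp only [lieDeriv, expMem_smul_liePMat]
  show deriv (fun t : ℝ => Φ (x * ι (expP (t • w))) j) 0 = _
  have h1 : HasFDerivAt (UnitaryGroup.CotangentForms.germAt ι Φ x)
      (fderiv ℝ (UnitaryGroup.CotangentForms.germAt ι Φ x) 0) ((0 : ℝ) • w) := by
    rw [zero_smul]; exact hd.hasFDerivAt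
  have h2 := h1.comp_hasDerivAt (0 : ℝ) ((hasDerivAt_id (0 : ℝ)).smul_const w)
  have h3 : HasDerivAt (fun t : ℝ => Φ (x * ι (expP (t • w))))
      (fderiv ℝ (UnitaryGroup.CotangentForms.germAt ι Φ x) 0 w) 0 := by
    rw [one_smul] at h2; exact h2
  have h4 : HasDerivAt (fun t : ℝ => Φ (x * ι (expP (t • w))) j)
      (fderiv ℝ (UnitaryGroup.CotangentForms.germAt ι Φ x) 0 w j) 0 :=
    ((ContinuousLinearMap.proj (R := ℝ) (φ := fun _ : Fin 2 => ℂ) j).hasFDerivAt).comp_hasDerivAt (0 : ℝ) h3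
  exact h4.deriv

variable {ι}

/-- **Cauchy–Riemann on the whole group from holomorphic germs**: if `Φ` has holomorphic germs along `ι` (★
`CotangentForms.IsHolGerm`: every germ `b ↦ Φ (x · ι(expP b))` is real-differentiable at `0` with complex-linear differential)
then `X_{ib} Φⱼ = i · X_b Φⱼ` at EVERY base point `x ∈ G`, i.e. `Φ` is annihilated by `𝔭₋`.
[cite: Borel1997, §5.14] [cite: BorelWallach2000, VII 2.10] -/
theorem lieDeriv_liePMat_I_smul_of_isHolGerm {Φ : G → (Fin 2 → ℂ)} (hΦ : UnitaryGroup.CotangentForms.IsHolGerm ι Φ)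
    (b : Fin 2 → ℂ) (j : Fin 2) :
    lieDeriv (H := u21Group) ι (liePMat (Complex.I • b)) (fun y => Φ y j) =
      Complex.I • lieDeriv (H := u21Group) ι (liePMat b) (fun y => Φ y j) := by
  funext x
  rw [lieDeriv_liePMat_eq_fderiv_germAt ι Φ x j _ (hΦ.1 x), Pi.smul_apply,
    lieDeriv_liePMat_eq_fderiv_germAt ι Φ x j _ (hΦ.1 x), hΦ.2 x b, Pi.smul_apply, smul_eq_mul]

end CR


/-! ## §4 The `K`-type relation along `exp tY`, `Y ∈ 𝔨`, and the infinitesimal `K`-type -/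

section KType

variable {G : Type*} [Group G] (ι : U21 →* G)

/-- A matrix commuting with `J = diag(1,1,−1)` has vanishing off-diagonal blocks. [folklore] -/
theorem apply_two_eq_zero_of_commute_J {M : Matrix (Fin 3) (Fin 3) ℂ} (h : M * J = J * M) (a : Fin 3) (ha : a ≠ 2) :
    M a 2 = 0 ∧ M 2 a = 0 := by
  have h1 := congrFun (congrFun h a) 2
  have h2 := congrFun (congrFun h 2) a
  fin_cases a
  · show M 0 2 = 0 ∧ M 2 0 = 0
    simp [J, Matrix.mul_apply, Matrix.diagonal] at h1 h2
    exact ⟨by linear_combination (-1 / 2 : ℂ) * h1, by linear_combination (1 / 2 : ℂ) * h2⟩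
  · show M 1 2 = 0 ∧ M 2 1 = 0
    simp [J, Matrix.mul_apply, Matrix.diagonal] at h1 h2
    exact ⟨by linear_combination (-1 / 2 : ℂ) * h1, by linear_combination (1 / 2 : ℂ) * h2⟩
  · exact absurd rfl ha

/-- The matrix of `exp X ∈ U(2,1)` is `exp X`. [folklore] -/
theorem mat_expMem (X : u21Group.lie) : mat (u21Group.expMem X) = NormedSpace.exp (X : Matrix (Fin 3) (Fin 3) ℂ) := rfl

/-- `exp (sY)` commutes with `J` when `Y` does. [folklore] -/
theorem exp_smul_mul_J_of_commute_J (Y : u21Group.lie)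
    (hY : (Y : Matrix (Fin 3) (Fin 3) ℂ) * J = J * (Y : Matrix (Fin 3) (Fin 3) ℂ)) (s : ℝ) :
    NormedSpace.exp (s • (Y : Matrix (Fin 3) (Fin 3) ℂ)) * J = J * NormedSpace.exp (s • (Y : Matrix (Fin 3) (Fin 3) ℂ)) := by
  have hc0 : Commute (s • (Y : Matrix (Fin 3) (Fin 3) ℂ)) J := by
    show (s • (Y : Matrix (Fin 3) (Fin 3) ℂ)) * J = J * (s • (Y : Matrix (Fin 3) (Fin 3) ℂ))
    rw [Matrix.smul_mul, Matrix.mul_smul, hY]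
  exact (hc0.exp_left).eq

/-- For `Y ∈ 𝔲(2,1)` commuting with `J` (i.e. `Y ∈ 𝔨 = 𝔲(2) ⊕ 𝔲(1)`), `exp (sY)` fixes the origin of the ball: it is an element of
`Stab(x₀)` (`exp sY` commutes with `J`, hence is block diagonal). [cite: BorelWallach2000, VI 4.7] -/
theorem exists_stabilizer_coe_eq_expMem (Y : u21Group.lie)
    (hY : (Y : Matrix (Fin 3) (Fin 3) ℂ) * J = J * (Y : Matrix (Fin 3) (Fin 3) ℂ)) (s : ℝ) :
    ∃ k : stabilizer (↥U21) x₀, (k : ↥U21) = u21Group.expMem (s • Y) := by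
  let g : ↥U21 := u21Group.expMem (s • Y)
  have hmat : mat g = NormedSpace.exp (s • (Y : Matrix (Fin 3) (Fin 3) ℂ)) := mat_expMem _
  have hg : g • x₀ = x₀ := by
    apply Subtype.ext
    funext i
    have hi : (Fin.castSucc i : Fin 3) ≠ 2 := by fin_cases i <;> decide
    rw [smul_val, W3_x₀, W3_x₀, hmat, (apply_two_eq_zero_of_commute_J (exp_smul_mul_J_of_commute_J Y hY s) _ hi).1, zero_div]
    rfl
  exact ⟨⟨g, mem_stabilizer_iff.mpr hg⟩, rfl⟩

/-- The inverse of `exp (−sY)` is `exp (sY)`. [folklore] -/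
theorem expMem_neg_smul_inv (Y : u21Group.lie) (s : ℝ) :
    (u21Group.expMem ((-s) • Y))⁻¹ = u21Group.expMem (s • Y) := by
  rw [inv_eq_iff_eq_inv]
  apply Subtype.ext
  rw [RealMatrixGroup.coe_expMem, Subgroup.coe_inv, RealMatrixGroup.coe_expMem, ← expGL_neg]
  congr 1
  show (-s) • (Y : Matrix (Fin 3) (Fin 3) ℂ) = -(s • (Y : Matrix (Fin 3) (Fin 3) ℂ))
  exact neg_smul s _

/-- **The `K`-type relation along `exp sY`, `Y ∈ 𝔨`**, read through `τ = weightOf x₀ = pMinus` (★ `weightOf_cotangent_apply`,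
`pMinus_apply`): for `Φ` of right `K_∞`-type `τ` along `ι`,
`Φ (x · ι(exp sY))ⱼ = (e^{-sY})₂₂ · ∑ᵢ conj((e^{-sY})ⱼᵢ) Φ(x)ᵢ`. [cite: BorelWallach2000, VI 4.8] [cite: Borel1997, §5.14] -/
theorem apply_mul_expMem_eq_of_weight (Φ : G → (Fin 2 → ℂ))
    (hK : ∀ (k : stabilizer (↥U21) x₀) (g : G),
      Φ (g * ι k) = (isPullbackCocycle_cotangentCocycle.weightOf x₀) k⁻¹ (Φ g))
    (Y : u21Group.lie) (hY : (Y : Matrix (Fin 3) (Fin 3) ℂ) * J = J * (Y : Matrix (Fin 3) (Fin 3) ℂ))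
    (x : G) (s : ℝ) (j : Fin 2) :
    Φ (x * ι (u21Group.expMem (s • Y))) j =
      NormedSpace.exp ((-s) • (Y : Matrix (Fin 3) (Fin 3) ℂ)) 2 2 *
        ∑ i : Fin 2, conj (NormedSpace.exp ((-s) • (Y : Matrix (Fin 3) (Fin 3) ℂ)) (Fin.castSucc j) (Fin.castSucc i)) * Φ x i := by
  obtain ⟨k, hk⟩ := exists_stabilizer_coe_eq_expMem Y hY (-s)
  have hkinv : ((k⁻¹ : stabilizer (↥U21) x₀) : U21) = u21Group.expMem (s • Y) := by
    rw [Subgroup.coe_inv, hk]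
    exact expMem_neg_smul_inv Y s
  have hmat : mat (k : U21) = NormedSpace.exp ((-s) • (Y : Matrix (Fin 3) (Fin 3) ℂ)) := by
    rw [hk]; exact mat_expMem _
  have h1 : Φ (x * ι (u21Group.expMem (s • Y))) = (isPullbackCocycle_cotangentCocycle.weightOf x₀) k (Φ x) := by
    have := hK k⁻¹ x
    rw [inv_inv, hkinv] at this
    exact this
  rw [h1, weightOf_cotangent_apply, stabilizerEquivK21_symm_apply, Literature.NumberTheory.Automorphic.U21.pMinus_apply]
  have hs : Literature.NumberTheory.Automorphic.U21.sclD (toK21 k) = mat (k : U21) 2 2 := rfl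
  have hA : Literature.NumberTheory.Automorphic.U21.matA (toK21 k) = ulBlock (k : U21) := rfl
  rw [hs, hA]
  simp only [Pi.smul_apply, smul_eq_mul, Matrix.mulVec, dotProduct, Matrix.transpose_apply,
    Matrix.conjTranspose_apply, Fin.sum_univ_two, ulBlock, Matrix.of_apply, hmat, Complex.star_def]

-- The scoped `L∞` operator norm on matrices (reducibly defeq to the Pi topology) is used for `hasDerivAt_exp_smul_const'`.
set_option backward.isDefEq.respectTransparency false in
open scoped Matrix.Norms.Operator in
/-- Entries of `t ↦ exp (−tY)` are differentiable at `0` with derivative `−Y`. [folklore] -/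
theorem hasDerivAt_exp_neg_smul_apply (Yv : Matrix (Fin 3) (Fin 3) ℂ) (a b : Fin 3) :
    HasDerivAt (fun t : ℝ => NormedSpace.exp ((-t) • Yv) a b) (-(Yv a b)) 0 := by
  have he : HasDerivAt (fun t : ℝ => NormedSpace.exp ((-t) • Yv)) (-Yv) 0 := by
    have h := hasDerivAt_exp_smul_const' (𝕂 := ℝ) (-Yv) 0
    simp only [zero_smul, NormedSpace.exp_zero, mul_one] at h
    refine h.congr_of_eventuallyEq (Filter.Eventually.of_forall fun t => ?_)
    simp [smul_neg, neg_smul]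
  have hL := ((LinearMap.toContinuousLinearMap (Matrix.entryLinearMap ℝ ℂ a b)).hasFDerivAt).comp_hasDerivAt (0 : ℝ) he
  convert hL using 1 <;> rfl

/-- **The infinitesimal `K`-type**: for `Φ` of right `K_∞`-type `τ = weightOf x₀` along `ι` and `Y ∈ 𝔨 = {Y ∈ 𝔲(2,1) | YJ = JY}`,
the Lie derivative `Y Φⱼ` is the explicit combination `−Y₂₂ Φⱼ − ∑ᵢ conj(Yⱼᵢ) Φᵢ` of the coordinates of `Φ` (derivative at `s = 0`
of the `K`-type relation along `exp sY`).  In particular `span{Φ₀, Φ₁}` is `𝔨`-stable. [cite: BorelWallach2000, VI 4.8]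
[cite: BorelJacquet1979, §1.5] -/
theorem lieDeriv_of_weight_eq (Φ : G → (Fin 2 → ℂ))
    (hK : ∀ (k : stabilizer (↥U21) x₀) (g : G),
      Φ (g * ι k) = (isPullbackCocycle_cotangentCocycle.weightOf x₀) k⁻¹ (Φ g))
    (Y : u21Group.lie) (hY : (Y : Matrix (Fin 3) (Fin 3) ℂ) * J = J * (Y : Matrix (Fin 3) (Fin 3) ℂ))
    (x : G) (j : Fin 2) :
    lieDeriv (H := u21Group) ι Y (fun y => Φ y j) x =
      -((Y : Matrix (Fin 3) (Fin 3) ℂ) 2 2) * Φ x j -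
        ∑ i : Fin 2, conj ((Y : Matrix (Fin 3) (Fin 3) ℂ) (Fin.castSucc j) (Fin.castSucc i)) * Φ x i := by
  set Yv : Matrix (Fin 3) (Fin 3) ℂ := (Y : Matrix (Fin 3) (Fin 3) ℂ) with hYv
  have hfun : (fun s : ℝ => Φ (x * ι (u21Group.expMem (s • Y))) j) = fun s : ℝ =>
      NormedSpace.exp ((-s) • Yv) 2 2 *
        ∑ i : Fin 2, star (NormedSpace.exp ((-s) • Yv) (Fin.castSucc j) (Fin.castSucc i)) * Φ x i := by
    funext s
    rw [apply_mul_expMem_eq_of_weight ι Φ hK Y hY x s j]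
    rfl
  have h22 := hasDerivAt_exp_neg_smul_apply Yv 2 2
  have hsum : HasDerivAt (fun s : ℝ => ∑ i : Fin 2, star (NormedSpace.exp ((-s) • Yv) (Fin.castSucc j) (Fin.castSucc i)) * Φ x i)
      (∑ i : Fin 2, star (-(Yv (Fin.castSucc j) (Fin.castSucc i))) * Φ x i) 0 := by
    refine HasDerivAt.fun_sum fun i _ => ?_
    exact ((hasDerivAt_exp_neg_smul_apply Yv (Fin.castSucc j) (Fin.castSucc i)).star).mul_const _
  have hprod := h22.fun_mul hsum
  have h0 : NormedSpace.exp ((-(0 : ℝ)) • Yv) = 1 := by rw [neg_zero, zero_smul, NormedSpace.exp_zero]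
  simp only [h0, Matrix.one_apply_eq] at hprod
  have hδ : ∀ i : Fin 2, (1 : Matrix (Fin 3) (Fin 3) ℂ) (Fin.castSucc j) (Fin.castSucc i) = if i = j then 1 else 0 := by
    intro i
    rw [Matrix.one_apply]
    by_cases h : i = j
    · subst h; simp
    · have h' : Fin.castSucc j ≠ Fin.castSucc i := fun e => h (Fin.castSucc_injective _ e).symm
      simp [h, h']
  simp only [hδ] at hprod
  rw [lieDeriv]
  show deriv (fun s : ℝ => Φ (x * ι (u21Group.expMem (s • Y))) j) 0 = _
  rw [hfun, hprod.deriv]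
  simp only [star_neg, Complex.star_def, apply_ite, map_one, map_zero, ite_mul, one_mul, zero_mul,
    Finset.sum_ite_eq', Finset.mem_univ, if_true, neg_mul, Finset.sum_neg_distrib]
  ring

/-- `h₀ = i·J = i·diag(1,1,−1)` acts on the coordinates of a form of `K_∞`-type `τ = weightOf x₀` by the scalar `2i`:
`h₀ Φⱼ = 2i · Φⱼ` (the cotangent `K`-type is the `z₀`-weight `2` line). [cite: BorelWallach2000, VI 4.8] -/
theorem lieDeriv_h0_of_weight (Φ : G → (Fin 2 → ℂ))
    (hK : ∀ (k : stabilizer (↥U21) x₀) (g : G),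
      Φ (g * ι k) = (isPullbackCocycle_cotangentCocycle.weightOf x₀) k⁻¹ (Φ g))
    (h₀ : u21Group.lie) (hh₀ : (h₀ : Matrix (Fin 3) (Fin 3) ℂ) = Complex.I • J) (j : Fin 2) :
    lieDeriv (H := u21Group) ι h₀ (fun y => Φ y j) = (2 * Complex.I) • fun y => Φ y j := by
  have hY : (h₀ : Matrix (Fin 3) (Fin 3) ℂ) * J = J * (h₀ : Matrix (Fin 3) (Fin 3) ℂ) := by
    rw [hh₀, Matrix.smul_mul, Matrix.mul_smul]
  funext x
  rw [lieDeriv_of_weight_eq ι Φ hK h₀ hY x j, Pi.smul_apply, smul_eq_mul, hh₀]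
  fin_cases j <;> simp [J, Matrix.diagonal, Fin.sum_univ_two] <;> ring

end KType


end Summit.HodgeConjecture.HodgeConjecture.Cruxes.H413.F0P2aArchOrthPrelim

end
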